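import Summits.BirchSwinnertonDyer.Rank1Residual.Supersingular.LocalOddTorsionAdicCompletionAt
import HarnessLib

/-!
# N4 (X6 ∧ r_an = 0) VISIBILITY offers — the local binders `#F(ℚ_w)[5] = 1` of the partners, KERNEL (x10b gen 23)

HONEST FRAMING (cell `b2b-bsdres`, run/shared/lean/b2b/bsd-rank1-residual/, verbatim in every file): the goal of the
cell is to DELETE the COMBINATION-SHAPED residual classes of the Birch–Swinnerton-Dyer formula for ALL analytic-rank `≤ 1`
elliptic curves over `ℚ` — "full BSD formula for every rank `≤ 1` curve in class `C`" assembled STRICTLY from published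
theorems — so that the rank-`≤ 1` remainder becomes exactly the CONSTRUCTION-SHAPED classes, which are TYPED (missing-input
`Prop`s), NOT attempted.  This is not "finishing BSD".
Cell `b2b-bsdres`, supersingular family, prover A = unit `b2b-bsdres-x10b` (gen 23).  Topic file; namespace
`Summit.BirchSwinnertonDyer.Rank1Residual.Supersingular`.  THEOREMS ONLY; no named fact, no definition, nothing booked; X6 / X7 stay
CONSTRUCTION-SHAPED; no mark / label / count moved.

## What

The rank-0 VISIBILITY offers (`Supersingular/X6Visibility*`, `X7Visibility*`, x10b gen 15–16) display, for the `p`-congruent partner `F` of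
positive rank, one LOCAL binder per place `w ∈ S` of free kind (i) and at the paid place `w = p`:
`∀ w, (primesEquiv w : ℕ) = ℓ → Nat.card (nsmulAddMonoidHom p : (F.baseChange (w.adicCompletion ℚ)).toAffine.Point →+ _).ker = 1`
(`#F(ℚ_ℓ)[p] = 1`; so far two-engine EVIDENCE).  Each theorem below is LITERALLY one such binder, proved in the KERNEL by the decider
`LocalOddTorsion.fiveTorsionCheckAt` / `sevenTorsionCheckAt` (`Supersingular/LocalOddTorsionDeciderAt.lean`: `nP = O ⟺ ψₙ(x) = 0`, AEC
Ex. 3.7(f) PROVED in the tree; abscissae `ℓ`-adic integers, AEC IV.3.2(b) / IV.6.1; Hensel root census with child sieve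
`RootCensusSieve.check₃`; fibres by the square class of `g`, Serre II §3.3) read in the visibility currency by
`LocalOddTorsionAdicCompletionAt`, on a certificate `(k, cert)` checked by `decide +kernel` (certificates: x10b gen 23
`certs/kind1_certs.json`, Python mirror `code/oddtors_cert.py`; every one has `S = 0`, agreeing with the gen 15/16 engines).
Usage in a twin: `(h2 := natCard_ker_five_partner_306432r1_at2 hFeq)`.  Labels in this file: `22678e1 @ 5`, `492414f1 @ 5`.

References: [SilvermanAEC2009] VII.3.1, Ex. 3.7, IV.6.1; [Serre1973] II §3.3; [CremonaMazur2000] §3; [Cremona2006] (labels, models).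
-/

set_option autoImplicit false

noncomputable section

open scoped Classical NumberField
open IsDedekindDomain NumberField WeierstrassCurve Rat.HeightOneSpectrum
open Summit.BirchSwinnertonDyer.Rank1Residual.Supersingular.LocalOddTorsion

namespace Summit.BirchSwinnertonDyer.Rank1Residual.Supersingular

/-! ### `22678e1 @ 5` — partner `F = ⟨1, 0, 0, -14128, -645920⟩` (`430882i1`) -/

/-- **`#ker([5] : F(ℚ_w)) = 1` at the place of `5`** for the `5`-congruent visibility partner `F = ⟨1, 0, 0, -14128, -645920⟩` = `430882i1` of the X6 cell `22678e1 @ 5` (the PAID place `w = p`; the binder `h5` of `bsdp_x6r0vis5_22678e1_5`, `bsdp_x6r0vis5_22678e1_5_of_congr`, `bsdp_x6r0vis_22678e1_5`, `bsdp_x6r0vis_22678e1_5_of_congr`): KERNEL — the decider `fiveTorsionCheckAt` at precision `k = 1` with certificate `[]` (no root of `ψ_5` in `ℤ_5`; `S = 0`), checked by `decide +kernel` (certificate found by x10b gen 23 `code/oddtors_cert.py`).  A TOOL-backed discharge of a displayed local binder; per pair; nothing booked. [cite: SilvermanAEC2009, VII.3.1 and Exercise 3.7] [cite: CremonaMazur2000,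 §3] -/
theorem natCard_ker_five_partner_22678e1_at5 {F : WeierstrassCurve ℚ} (hFeq : F = ⟨1, 0, 0, -14128, -645920⟩) :
    ∀ w : HeightOneSpectrum (𝓞 ℚ), (primesEquiv w : ℕ) = 5 →
      Nat.card (nsmulAddMonoidHom 5 : (F.baseChange (w.adicCompletion ℚ)).toAffine.Point →+ _).ker = 1 := by
  intro w hw
  haveI : Fact (Nat.Prime 5) := ⟨by norm_num⟩
  refine natCard_ker_nsmul_five_adicCompletion_eq_one_of_checkAt 5 1 0 0 (-14128) (-645920) (by decide +kernel)
    (k := 1) (cert := []) (by decide +kernel) F ?_ hw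
  rw [hFeq]; ext <;> norm_num

/-- **`#ker([5] : F(ℚ_w)) = 1` at the place of `17`** for the `5`-congruent visibility partner `F = ⟨1, 0, 0, -14128, -645920⟩` = `430882i1` of the X6 cell `22678e1 @ 5` (free kind (i); the binder `h17` of `bsdp_x6r0vis5_22678e1_5`, `bsdp_x6r0vis5_22678e1_5_of_congr`, `bsdp_x6r0vis_22678e1_5`, `bsdp_x6r0vis_22678e1_5_of_congr`): KERNEL — the decider `fiveTorsionCheckAt` at precision `k = 1` with certificate `[]` (no root of `ψ_5` in `ℤ_17`; `S = 0`), checked by `decide +kernel` (certificate found by x10b gen 23 `code/oddtors_cert.py`).  A TOOL-backed discharge of a displayed local binder; per pair; nothing booked. [cite: SilvermanAEC2009, VII.3.1 and Exercise 3.7] [cite: CremonaMazur2000, §3] -/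
theorem natCard_ker_five_partner_22678e1_at17 {F : WeierstrassCurve ℚ} (hFeq : F = ⟨1, 0, 0, -14128, -645920⟩) :
    ∀ w : HeightOneSpectrum (𝓞 ℚ), (primesEquiv w : ℕ) = 17 →
      Nat.card (nsmulAddMonoidHom 5 : (F.baseChange (w.adicCompletion ℚ)).toAffine.Point →+ _).ker = 1 := by
  intro w hw
  haveI : Fact (Nat.Prime 17) := ⟨by norm_num⟩
  refine natCard_ker_nsmul_five_adicCompletion_eq_one_of_checkAt 17 1 0 0 (-14128) (-645920) (by decide +kernel)
    (k := 1) (cert := []) (by decide +kernel) F ?_ hw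
  rw [hFeq]; ext <;> norm_num

/-- **`#ker([5] : F(ℚ_w)) = 1` at the place of `23`** for the `5`-congruent visibility partner `F = ⟨1, 0, 0, -14128, -645920⟩` = `430882i1` of the X6 cell `22678e1 @ 5` (free kind (i); the binder `h23` of `bsdp_x6r0vis5_22678e1_5`, `bsdp_x6r0vis5_22678e1_5_of_congr`, `bsdp_x6r0vis_22678e1_5`, `bsdp_x6r0vis_22678e1_5_of_congr`): KERNEL — the decider `fiveTorsionCheckAt` at precision `k = 1` with certificate `[]` (no root of `ψ_5` in `ℤ_23`; `S = 0`), checked by `decide +kernel` (certificate found by x10b gen 23 `code/oddtors_cert.py`).  A TOOL-backed discharge of a displayed local binder; per pair; nothing booked. [cite: SilvermanAEC2009, VII.3.1 and Exercise 3.7] [cite: CremonaMazur2000, §3] -/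
theorem natCard_ker_five_partner_22678e1_at23 {F : WeierstrassCurve ℚ} (hFeq : F = ⟨1, 0, 0, -14128, -645920⟩) :
    ∀ w : HeightOneSpectrum (𝓞 ℚ), (primesEquiv w : ℕ) = 23 →
      Nat.card (nsmulAddMonoidHom 5 : (F.baseChange (w.adicCompletion ℚ)).toAffine.Point →+ _).ker = 1 := by
  intro w hw
  haveI : Fact (Nat.Prime 23) := ⟨by norm_num⟩
  refine natCard_ker_nsmul_five_adicCompletion_eq_one_of_checkAt 23 1 0 0 (-14128) (-645920) (by decide +kernel)
    (k := 1) (cert := []) (by decide +kernel) F ?_ hw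
  rw [hFeq]; ext <;> norm_num

/-! ### `492414f1 @ 5` — partner `F = ⟨1, 1, 1, -203276888, 1060005312281⟩` -/

/-- **`#ker([5] : F(ℚ_w)) = 1` at the place of `3`** for the `5`-congruent visibility partner `F = ⟨1, 1, 1, -203276888, 1060005312281⟩` = the partner curve of the X6 cell `492414f1 @ 5` (free kind (i); the binder `h3` of `bsdp_x6r0vis_492414f1_5`, `bsdp_x6r0vis_492414f1_5_of_congr`): KERNEL — the decider `fiveTorsionCheckAt` at precision `k = 2` with certificate `[]` (no root of `ψ_5` in `ℤ_3`; `S = 0`), checked by `decide +kernel` (certificate found by x10b gen 23 `code/oddtors_cert.py`).  A TOOL-backed discharge of a displayed local binder; per pair; nothing booked. [cite: SilvermanAEC2009, VII.3.1 and Exercise 3.7] [cite: CremonaMazur2000, §3] -/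
theorem natCard_ker_five_partner_492414f1_at3 {F : WeierstrassCurve ℚ} (hFeq : F = ⟨1, 1, 1, -203276888, 1060005312281⟩) :
    ∀ w : HeightOneSpectrum (𝓞 ℚ), (primesEquiv w : ℕ) = 3 →
      Nat.card (nsmulAddMonoidHom 5 : (F.baseChange (w.adicCompletion ℚ)).toAffine.Point →+ _).ker = 1 := by
  intro w hw
  haveI : Fact (Nat.Prime 3) := ⟨by norm_num⟩
  refine natCard_ker_nsmul_five_adicCompletion_eq_one_of_checkAt 3 1 1 1 (-203276888) 1060005312281 (by decide +kernel)
    (k := 2) (cert := []) (by decide +kernel) F ?_ hw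
  rw [hFeq]; ext <;> norm_num

/-- **`#ker([5] : F(ℚ_w)) = 1` at the place of `5`** for the `5`-congruent visibility partner `F = ⟨1, 1, 1, -203276888, 1060005312281⟩` = the partner curve of the X6 cell `492414f1 @ 5` (the PAID place `w = p`; the binder `h5` of `bsdp_x6r0vis_492414f1_5`, `bsdp_x6r0vis_492414f1_5_of_congr`): KERNEL — the decider `fiveTorsionCheckAt` at precision `k = 2` with certificate `[]` (no root of `ψ_5` in `ℤ_5`; `S = 0`), checked by `decide +kernel` (certificate found by x10b gen 23 `code/oddtors_cert.py`).  A TOOL-backed discharge of a displayed local binder; per pair; nothing booked. [cite: SilvermanAEC2009, VII.3.1 and Exercise 3.7] [cite: CremonaMazur2000, §3] -/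
theorem natCard_ker_five_partner_492414f1_at5 {F : WeierstrassCurve ℚ} (hFeq : F = ⟨1, 1, 1, -203276888, 1060005312281⟩) :
    ∀ w : HeightOneSpectrum (𝓞 ℚ), (primesEquiv w : ℕ) = 5 →
      Nat.card (nsmulAddMonoidHom 5 : (F.baseChange (w.adicCompletion ℚ)).toAffine.Point →+ _).ker = 1 := by
  intro w hw
  haveI : Fact (Nat.Prime 5) := ⟨by norm_num⟩
  refine natCard_ker_nsmul_five_adicCompletion_eq_one_of_checkAt 5 1 1 1 (-203276888) 1060005312281 (by decide +kernel)
    (k := 2) (cert := []) (by decide +kernel) F ?_ hw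
  rw [hFeq]; ext <;> norm_num

/-- **`#ker([5] : F(ℚ_w)) = 1` at the place of `13`** for the `5`-congruent visibility partner `F = ⟨1, 1, 1, -203276888, 1060005312281⟩` = the partner curve of the X6 cell `492414f1 @ 5` (free kind (i); the binder `h13` of `bsdp_x6r0vis_492414f1_5`, `bsdp_x6r0vis_492414f1_5_of_congr`): KERNEL — the decider `fiveTorsionCheckAt` at precision `k = 1` with certificate `[]` (no root of `ψ_5` in `ℤ_13`; `S = 0`), checked by `decide +kernel` (certificate found by x10b gen 23 `code/oddtors_cert.py`).  A TOOL-backed discharge of a displayed local binder; per pair; nothing booked. [cite: SilvermanAEC2009, VII.3.1 and Exercise 3.7] [cite: CremonaMazur2000, §3] -/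
theorem natCard_ker_five_partner_492414f1_at13 {F : WeierstrassCurve ℚ} (hFeq : F = ⟨1, 1, 1, -203276888, 1060005312281⟩) :
    ∀ w : HeightOneSpectrum (𝓞 ℚ), (primesEquiv w : ℕ) = 13 →
      Nat.card (nsmulAddMonoidHom 5 : (F.baseChange (w.adicCompletion ℚ)).toAffine.Point →+ _).ker = 1 := by
  intro w hw
  haveI : Fact (Nat.Prime 13) := ⟨by norm_num⟩
  refine natCard_ker_nsmul_five_adicCompletion_eq_one_of_checkAt 13 1 1 1 (-203276888) 1060005312281 (by decide +kernel)
    (k := 1) (cert := []) (by decide +kernel) F ?_ hw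
  rw [hFeq]; ext <;> norm_num

/-- **`#ker([5] : F(ℚ_w)) = 1` at the place of `107`** for the `5`-congruent visibility partner `F = ⟨1, 1, 1, -203276888, 1060005312281⟩` = the partner curve of the X6 cell `492414f1 @ 5` (free kind (i); the binder `h107` of `bsdp_x6r0vis_492414f1_5`, `bsdp_x6r0vis_492414f1_5_of_congr`): KERNEL — the decider `fiveTorsionCheckAt` at precision `k = 2` with certificate `[]` (no root of `ψ_5` in `ℤ_107`; `S = 0`), checked by `decide +kernel` (certificate found by x10b gen 23 `code/oddtors_cert.py`).  A TOOL-backed discharge of a displayed local binder; per pair; nothing booked. [cite: SilvermanAEC2009, VII.3.1 and Exercise 3.7] [cite: CremonaMazur2000, §3] -/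
theorem natCard_ker_five_partner_492414f1_at107 {F : WeierstrassCurve ℚ} (hFeq : F = ⟨1, 1, 1, -203276888, 1060005312281⟩) :
    ∀ w : HeightOneSpectrum (𝓞 ℚ), (primesEquiv w : ℕ) = 107 →
      Nat.card (nsmulAddMonoidHom 5 : (F.baseChange (w.adicCompletion ℚ)).toAffine.Point →+ _).ker = 1 := by
  intro w hw
  haveI : Fact (Nat.Prime 107) := ⟨by norm_num⟩
  refine natCard_ker_nsmul_five_adicCompletion_eq_one_of_checkAt 107 1 1 1 (-203276888) 1060005312281 (by decide +kernel)
    (k := 2) (cert := []) (by decide +kernel) F ?_ hw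
  rw [hFeq]; ext <;> norm_num

end Summit.BirchSwinnertonDyer.Rank1Residual.Supersingular

end
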